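import Literature.MathematicalPhysics.QuantumFieldTheory.Balaban1983to89.B9Thm31GpAgmonDecayCoarseZd
import Literature.MathematicalPhysics.QuantumFieldTheory.Balaban1983to89.B9Eq324ConjugatedFormZd

/-!
# `Balaban1983to89.B9Eq346AgmonLaplacianZd` — [Balaban1985BackgroundPropagators] Thm 3.1 (3.42) n = 2 ∕ (3.46) p. 398, THE LAPLACIAN ENTRY («‖hζΔ_U G′(U)λ‖(Lʲη)² ≦
# B₀(Lʲη)(Lʲ′η)e^{−δ₀d}‖h‖‖λ‖») FOR THE GENUINE `G′(U₀)` AT THE `ℤᵈ` CARRIER: OFF THE SOURCE, `Δ^η_{U₀}G′(U₀)Ψ = −(Q′*aQ′)G′(U₀)Ψ` (the equation `Δ′_aG′Ψ = Ψ`), and the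
# penalty is BLOCK-LOCAL with size `a_j(Lᵈ)^{−j}` — so every pointwise kernel bound for `G′` passes to `Δ^η_{U₀}G′` at the price of the penalty scale at `x`:
# ★★★ `|(Δ^η_{U₀}G′(U₀)δ_y w)(x)|_τ ≤ (Σ_{j≤m}𝟙[yʲ(x)∈Λ_j]a_j(Lᵈ)^{−j}e^{κ′(Lʲ−1)})·K·e^{−κ′|x−y|_∞}` whenever `|(G′δ_y w)(x′)|_τ ≤ K·e^{−κ′|x′−y|_∞}` on `Ω₀` (`x ∈ Ω₀`,
# `x ≠ y`) — with the coarse Agmon bound of `B9Thm31GpAgmonDecayCoarseZd` this is print's `B₀(Lʲ′η)∕(Lʲη)·e^{−δ₀d}` at level masses, member-uniform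

statement-level skeleton of published theorems with citation tags; proofs where landed; nothing here is a claim about the
Yang–Mills mass gap

`[Balaban1985BackgroundPropagators]` ("B9", CMP **99** (1985) 389–434) (3.42) p. 397 (the entries `n = 0, 1, 2` with factors `(Lʲη)^{2−n}`), (3.46) p. 398 *«‖hζΔ_U G′(U)λ‖(Lʲη)² … ≦
B₀(Lʲη)(Lʲ′η)e^{−δ₀d(y,y′)}‖h‖‖λ‖»*, (3.24) p. 394 (`Δ′_a = Δ^η_U + Q′*aQ′`, so `Δ^η_U G′ = I − Q′*aQ′G′` on `Ω₀`).  Print: random walk (Sect. B).  THIS FILE reads the Laplacian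
entry off the EQUATION: at a site `x ∈ Ω₀` off the support of `Ψ`, `(Δ^η_{U₀}G′Ψ)(x) = −Σ_j a_j(Q′_jᵀ𝟙_{Λ_j}Q′_jG′Ψ)(x)`, and the `τ`-transpose of the `j`-fold averaging
is bounded sitewise by `(Lᵈ)^{−j}|(Q′_jG′Ψ)(yʲ(x))|_τ` (Riesz, dag-n06-w2 g4's `fnorm_transposeOn_le_of_bound` with dag-n06-w4 g2's `QprimeIter_single` and g5's `fnorm_trIter`),
itself `≤ (Lᵈ)^{−2j}Σ_{Bʲ(yʲ(x))∩Ω₀}|G′Ψ|_τ` (this seat's `fnorm_QprimeIter_le`) — a block average of the kernel, which an exponential majorant passes at the cost `e^{κ′(Lʲ−1)}`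
(`≤ e` for the coarse rate `κ′ = κL^{−m}`, `κ ≤ 1`, `j ≤ m`).  With the scaling slot `Σ_j𝟙a_j(Lᵈ)^{−j} ≤ A·M(x)` and FILE 4's pointwise bound `K = 1∕((1−θ)c₀√(M_·M_y))`
floored by masses `≥ M_lo` on the block, the amplitude is `e·A·M(x)∕((1−θ)c₀√(M_loM_y))` — print's `(Lʲ′η)∕(Lʲη)` at level masses.

CITATION HEADER (lean-in-tree rule).  Cell `pub-ymgap` (YM Track A, HUMAN RULING D-0062 ∕ D-0149 width push), DAG node N06 = [B9], width seat
`pub-ymgap-dag-n06-w2` (g5), CLAIM-10.  Inputs BY NAME: g4's `fnorm_transposeOn_le_of_bound` (`B9Thm31GpDecayOfCoerciveZd`), w4 g2's `deltaPrimeAZd_apply ∕ deltaPrimeADom_coe ∕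
transposeOn ∕ QprimeIter_single ∕ deltaPrimeADom_GpZd`, w4 g5's `fnorm_trIter`, this seat's `fnorm_QprimeIter_le` (FILE 2b), `linfDist_le_of_blockMap_iterate_eq` (g4),
`blockMapIter_eq_iterate` (FILE 4), the engine.  Nothing restated.

WHAT IS PROVED (kernel, 0 sorry, 0 def; no `instance`, no `notation`).
* §1 ★★ `fnorm_transposeOn_QprimeLin_le` — THE SITEWISE SIZE OF THE `τ`-TRANSPOSE OF `Q′_j`: `|(Q′_jᵀ_Λ g)(x)|_τ ≤ 𝟙[yʲ(x)∈Λ]·(Lᵈ)^{−j}·|g(yʲ(x))|_τ` (unitary averaged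
  transporters below `j`, tracial Hermitian faithful `τ`).
* §2 ★★ `fnorm_penalty_apply_le` — `|(Δ′_a(U₀)Φ)(x) − (Δ^η_{U₀}Φ)(x)|_τ ≤ Σ_{j≤m}𝟙[yʲ(x)∈Λ_j]·a_j(Lᵈ)^{−2j}·Σ_{x′∈Ω₀, yʲ(x′)=yʲ(x)}|Φ(x′)|_τ` for `Φ ∈ L²(Ω₀, ·)`, `a ≥ 0`.
* §3 ★★ `covLap_GpZd_eq_neg_penalty_off` — OFF THE SOURCE (`x ∈ Ω₀`, `Ψ(x) = 0`): `|(Δ^η_{U₀}G′(U₀)Ψ)(x)|_τ = |(Δ′_aG′Ψ)(x) − (Δ^η_{U₀}G′Ψ)(x)|_τ`, hence the §2 bound;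
  `blockAvg_exp_le` (`(Lᵈ)^{−j}Σ_{x′∈Ω₀, yʲ(x′)=yʲ(x)}e^{−κ′|x′−y|_∞} ≤ e^{κ′(Lʲ−1)}e^{−κ′|x−y|_∞}`, `κ′ ≥ 0`, `L ≥ 1`).
* §4 ★★★ `fnorm_covLap_GpZd_single_le_of_kernelBound` — THE LAPLACIAN ENTRY FROM A KERNEL MAJORANT: `|(G′(U₀)δ_y w)(x′)|_τ ≤ K·e^{−κ′|x′−y|_∞}` for `x′ ∈ Ω₀` ⟹ for `x ∈ Ω₀`,
  `x ≠ y`: `|(Δ^η_{U₀}G′(U₀)δ_y w)(x)|_τ ≤ (Σ_{j≤m}𝟙[yʲ(x)∈Λ_j]a_j(Lᵈ)^{−j}e^{κ′(Lʲ−1)})·K·e^{−κ′|x−y|_∞}`; ★★★ `fnorm_covLap_GpZd_single_le_coarse` — with FILE 4's coarse bound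
  (`κ′ = κL^{−m}`, `0 ≤ κ ≤ 1`, `κ(6dB + 15A) ≤ θc₀`, scaling slots, masses `≥ M_lo > 0` on `Ω₀`):
  `|(Δ^η_{U₀}G′(U₀)δ_y w)(x)|_τ ≤ (e·A·M(x)∕((1−θ)c₀√(M_loM_y)))·e^{−κL^{−m}|x−y|_∞}·|w|_τ`.

HONEST SCOPE.  A REDUCTION with explicit constants (displayed `hco`, scaling slots, mass floor — discharged at cube members by FILES 5–7 of this seat, where `M_lo = m₈(ηLᵐ)⁻²` and
`M(x) = m₈(ηL^{j(x)})⁻²`); pointwise `L²_τ`-derived bound, single coarsest rate; the ON-SOURCE site `x = y` and the Hölder∕sup entries are not here.  Count-neutral; N05 ∕ N06 NOT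
discharged; K1⁹ `stmt-QuantumFields-27364` NOT closed; one finite `𝕋⁴` programme at fixed `ε`, Bałaban as printed; R4 closes only the conditional finite-`𝕋⁴` rung `BalabanLadder.UV`
— nothing continuum ∕ ℝ⁴ ∕ OS ∕ mass gap ∕ Clay.  Unit `pub-ymgap-dag-n06-w2` (g5), 2026-08-28.
-/

noncomputable section

open scoped BigOperators

namespace Literature.MathematicalPhysics.QuantumFieldTheory.Balaban1983to89.B9Eq346AgmonLaplacianZd

open Literature.MathematicalPhysics.QuantumLattice (blockMap)
open B7Prop1Explicit (e)
open B7Eq78Linearization (conjR QprimeIter zdBlocking)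
open B7Prop2Explicit (unitaryUnits)
open B8Ineq132 (covDerivFwd)
open B8Eq119TwistedAxial (bgT)
open B8Eq138LandauZd (covLap)
open B9Eq321LandauProjectionZd (suppSub formE formE_apply)
open B9Eq324DeltaPrimeAZd (single restrictSite restrictSite_coe transposeOn QprimeLin QprimeLin_apply deltaPrimeAZd deltaPrimeAZd_apply deltaPrimeADom
  deltaPrimeADom_coe GpZd deltaPrimeADom_GpZd)
open B9Eq325QprimeSingleSiteZd (blockMapIter trIter QprimeIter_single)
open B9Eq325QprimeStarLowerBoundZd (fnorm_trIter)
open B9Eq342CombesThomasFormZd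
open B9Thm31GpDecayOfCoerciveZd (fnorm_transposeOn_le_of_bound fnorm_neg' linfDist_le_of_blockMap_iterate_eq)
open B9Eq324ConjugatedFormZd (fnorm_QprimeIter_le card_filter_blockMapIter_le)
open B9Thm31GpAgmonDecayCoarseZd (fnorm_GpZd_single_le_exp_coarse blockMapIter_eq_iterate)
open LatticeNorms (linfDist)

export B7Prop1Explicit (Site)

variable {d : ℕ} {𝔸 : Type*} [CStarAlgebra 𝔸]

/-! ## §1  The sitewise size of the `τ`-transpose of `Q′_j` -/

section Transpose

variable (τ : 𝔸 →ₗ[ℂ] ℂ) [FiniteDimensional ℝ 𝔸] (hτp : ∀ a : 𝔸, a ≠ 0 → 0 < (τ (star a * a)).re) {L : ℕ} [NeZero L] {U₀ : Site d → Fin d → 𝔸ˣ}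

/-- ★★ **`|(Q′_jᵀ_Λ g)(x)|_τ ≤ 𝟙[yʲ(x) ∈ Λ]·(Lᵈ)^{−j}·|g(yʲ(x))|_τ`** (`yʲ(x) = blockMap^[j] x`; unitary averaged transporters below `j`, tracial Hermitian faithful `τ`): the Riesz vector
of `X ↦ Σ_{c∈Λ}Re τ((Q′_j δ_x X)(c)* g(c)) = 𝟙[yʲ(x)∈Λ]·Re τ((trIter_j x X)* g(yʲ(x)))`, and `|trIter_j x X|_τ = (Lᵈ)^{−j}|X|_τ`.
[cite: Balaban1985BackgroundPropagators, (3.24) p.394 («Q′*aQ′ … the same quadratic form»), (3.19) p.393, p.391] -/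
theorem fnorm_transposeOn_QprimeLin_le (hτt : ∀ a b : 𝔸, τ (a * b) = τ (b * a)) (hτs : ∀ a : 𝔸, τ (star a) = starRingEnd ℂ (τ a))
    {j : ℕ} (hT : ∀ j', j' < j → ∀ z y : Site d, bgT L U₀ j' z y ∈ unitaryUnits 𝔸) (Λ : Finset (Site d)) (g : Site d → 𝔸) (x : Site d) :
    fnorm τ (transposeOn τ hτp (QprimeLin L U₀ j) Λ g x) ≤
      (if blockMapIter L j x ∈ Λ then (((L : ℝ) ^ d)⁻¹) ^ j * fnorm τ (g (blockMapIter L j x)) else 0) := by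
  classical
  refine fnorm_transposeOn_le_of_bound τ hτp (QprimeLin L U₀ j) Λ g x
    (by split_ifs; exacts [mul_nonneg (by positivity) (fnorm_nonneg τ _), le_rfl]) fun X => ?_
  -- the functional: only the block label `yʲ(x)` contributes
  have hsum : ∑ c ∈ Λ, (τ (star (QprimeLin L U₀ j (single x X) c) * g c)).re =
      (if blockMapIter L j x ∈ Λ then (τ (star (trIter L U₀ j x X) * g (blockMapIter L j x))).re else 0) := by
    have hterm : ∀ c ∈ Λ, (τ (star (QprimeLin L U₀ j (single x X) c) * g c)).re =
        (if blockMapIter L j x = c then (τ (star (trIter L U₀ j x X) * g c)).re else 0) := by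
      intro c _
      rw [QprimeLin_apply, QprimeIter_single L U₀ x X j c]
      by_cases h : blockMapIter L j x = c
      · rw [if_pos h, if_pos h]
      · rw [if_neg h, if_neg h, star_zero, zero_mul, map_zero, Complex.zero_re]
    rw [Finset.sum_congr rfl hterm, Finset.sum_ite_eq]
  rw [hsum]
  by_cases hmem : blockMapIter L j x ∈ Λ
  · rw [if_pos hmem, if_pos hmem]
    calc |(τ (star (trIter L U₀ j x X) * g (blockMapIter L j x))).re| ≤ fnorm τ (trIter L U₀ j x X) * fnorm τ (g (blockMapIter L j x)) :=
          abs_fibreForm_le hτp hτs _ _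
      _ = (((L : ℝ) ^ d)⁻¹) ^ j * fnorm τ (g (blockMapIter L j x)) * fnorm τ X := by rw [fnorm_trIter τ hτt x X j hT]; ring
  · rw [if_neg hmem, if_neg hmem, abs_zero, zero_mul]

end Transpose

/-! ## §2  The penalty at a site -/

section Penalty

variable (τ : 𝔸 →ₗ[ℂ] ℂ) [FiniteDimensional ℝ 𝔸] (hτp : ∀ a : 𝔸, a ≠ 0 → 0 < (τ (star a * a)).re) {L : ℕ} [NeZero L] {U₀ : Site d → Fin d → 𝔸ˣ} {η : ℝ}
  {s : Finset (Site d)}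

/-- ★★ **THE PENALTY AT A SITE**: `|(Δ′_a(U₀)Φ)(x) − (Δ^η_{U₀}Φ)(x)|_τ ≤ Σ_{j≤m}𝟙[yʲ(x)∈Λ_j]·a_j·(Lᵈ)^{−2j}·Σ_{x′∈Ω₀, yʲ(x′)=yʲ(x)}|Φ(x′)|_τ` for `Φ ∈ L²(Ω₀, ·)`, `a ≥ 0`, unitary
averaged transporters below `m`. [cite: Balaban1985BackgroundPropagators, (3.24) p.394, (3.19) p.393] -/
theorem fnorm_penalty_apply_le (hτt : ∀ a b : 𝔸, τ (a * b) = τ (b * a)) (hτs : ∀ a : 𝔸, τ (star a) = starRingEnd ℂ (τ a))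
    {m : ℕ} (hT : ∀ j', j' < m → ∀ z y : Site d, bgT L U₀ j' z y ∈ unitaryUnits 𝔸) {a : ℕ → ℝ} (ha : ∀ j, 0 ≤ a j) (Λ : ℕ → Finset (Site d))
    (Φ : suppSub (𝔸 := 𝔸) s) (x : Site d) :
    fnorm τ (deltaPrimeAZd L U₀ η τ hτp m a Λ (Φ : Site d → 𝔸) x - covLap η U₀ (Φ : Site d → 𝔸) x) ≤
      ∑ j ∈ Finset.range (m + 1), (if blockMapIter L j x ∈ Λ j then
        a j * ((((L : ℝ) ^ d)⁻¹) ^ j * ((((L : ℝ) ^ d)⁻¹) ^ j * ∑ x' ∈ s.filter (fun x' => blockMapIter L j x' = blockMapIter L j x), fnorm τ ((Φ : Site d → 𝔸) x')))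
        else 0) := by
  rw [deltaPrimeAZd_apply, add_sub_cancel_left]
  refine (fnorm_sum_le hτp hτs _ _).trans (Finset.sum_le_sum fun j hj => ?_)
  have hjm : j < m + 1 := Finset.mem_range.1 hj
  have hTj : ∀ j', j' < j → ∀ z y : Site d, bgT L U₀ j' z y ∈ unitaryUnits 𝔸 := fun j' hj' => hT j' (by omega)
  rw [fnorm_smul, abs_of_nonneg (ha j)]
  have h1 := fnorm_transposeOn_QprimeLin_le τ hτp hτt hτs hTj (Λ j) (QprimeIter (zdBlocking d L) (bgT L U₀) j (Φ : Site d → 𝔸)) x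
  by_cases hmem : blockMapIter L j x ∈ Λ j
  · rw [if_pos hmem] at h1
    rw [if_pos hmem]
    refine mul_le_mul_of_nonneg_left (h1.trans ?_) (ha j)
    exact mul_le_mul_of_nonneg_left (fnorm_QprimeIter_le τ hτp hτt hτs hTj (fun z hz => Φ.2 z hz) _) (by positivity)
  · rw [if_neg hmem] at h1
    rw [if_neg hmem]
    have h0 : fnorm τ (transposeOn τ hτp (QprimeLin L U₀ j) (Λ j) (QprimeIter (zdBlocking d L) (bgT L U₀) j (Φ : Site d → 𝔸)) x) = 0 :=
      le_antisymm h1 (fnorm_nonneg τ _)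
    rw [h0, mul_zero]

end Penalty

/-! ## §3  Off the source: the Laplacian of `G′Ψ` is minus the penalty; block averages of an exponential -/

section OffSource

variable (L : ℕ) (U₀ : Site d → Fin d → 𝔸ˣ) (η : ℝ) (τ : 𝔸 →ₗ[ℂ] ℂ) [FiniteDimensional ℝ 𝔸]
  (hτp : ∀ a : 𝔸, a ≠ 0 → 0 < (τ (star a * a)).re) (m : ℕ) (a : ℕ → ℝ) (Λ : ℕ → Finset (Site d)) (s : Finset (Site d))

/-- ★★ **OFF THE SOURCE THE LAPLACIAN IS MINUS THE PENALTY**: for `Φ = G′(U₀)Ψ` and `x ∈ Ω₀` with `Ψ(x) = 0`, `(Δ′_aΦ)(x) = Ψ(x) = 0`, so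
`|(Δ^η_{U₀}Φ)(x)|_τ = |(Δ′_aΦ)(x) − (Δ^η_{U₀}Φ)(x)|_τ`. [cite: Balaban1985BackgroundPropagators, (3.24) p.394 («Its inverse is denoted by G′»), (3.42) p.397] -/
theorem fnorm_covLap_GpZd_eq_off [NeZero L] (hd : 0 < d) (hη : η ≠ 0) (hτt : ∀ a b : 𝔸, τ (a * b) = τ (b * a))
    (hτs : ∀ a : 𝔸, τ (star a) = starRingEnd ℂ (τ a)) (hU : ∀ (x : Site d) (κ : Fin d), U₀ x κ ∈ unitaryUnits 𝔸) (ha : ∀ j, 0 ≤ a j)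
    (Ψ : suppSub (𝔸 := 𝔸) s) {x : Site d} (hx : x ∈ s) (hΨx : (Ψ : Site d → 𝔸) x = 0) :
    fnorm τ (covLap η U₀ (GpZd L U₀ η τ hτp m a Λ s hd hη hτt hτs hU ha Ψ : Site d → 𝔸) x) =
      fnorm τ (deltaPrimeAZd L U₀ η τ hτp m a Λ (GpZd L U₀ η τ hτp m a Λ s hd hη hτt hτs hU ha Ψ : Site d → 𝔸) x -
        covLap η U₀ (GpZd L U₀ η τ hτp m a Λ s hd hη hτt hτs hU ha Ψ : Site d → 𝔸) x) := by
  set Φ := GpZd L U₀ η τ hτp m a Λ s hd hη hτt hτs hU ha Ψ with hΦ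
  have heq : deltaPrimeAZd L U₀ η τ hτp m a Λ (Φ : Site d → 𝔸) x = 0 := by
    have h0 : deltaPrimeADom L U₀ η τ hτp m a Λ s Φ = Ψ := deltaPrimeADom_GpZd hd hη hτt hτs hU ha Ψ
    have h := congrArg (fun f : suppSub (𝔸 := 𝔸) s => (f : Site d → 𝔸) x) h0
    simp only [deltaPrimeADom_coe, Set.indicator_of_mem (Finset.mem_coe.2 hx)] at h
    rw [h, hΨx]
  rw [heq, zero_sub, fnorm_neg']

omit [CStarAlgebra 𝔸] in
/-- **BLOCK AVERAGE OF AN EXPONENTIAL**: `(Lᵈ)^{−j}·Σ_{x′∈Ω₀, yʲ(x′)=yʲ(x)}e^{−κ′|x′−y|_∞} ≤ e^{κ′(Lʲ−1)}·e^{−κ′|x−y|_∞}` (`κ′ ≥ 0`, `L ≥ 1`): every site of the block is within `Lʲ − 1`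
of `x`, and the block has at most `(Lᵈ)ʲ` sites. [folklore] [cite: Balaban1985BackgroundPropagators, (3.42) p.397 (bookkeeping)] -/
theorem blockAvg_exp_le [NeZero L] (hL : 1 ≤ L) {κ' : ℝ} (hκ' : 0 ≤ κ') (j : ℕ) (x y : Site d) :
    (((L : ℝ) ^ d)⁻¹) ^ j * ∑ x' ∈ s.filter (fun x' => blockMapIter L j x' = blockMapIter L j x), Real.exp (-(κ' * ((linfDist x' y : ℕ) : ℝ))) ≤
      Real.exp (κ' * ((L : ℝ) ^ j - 1)) * Real.exp (-(κ' * ((linfDist x y : ℕ) : ℝ))) := by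
  classical
  set F := s.filter (fun x' => blockMapIter L j x' = blockMapIter L j x) with hF
  have hL0 : (0 : ℝ) < L := by exact_mod_cast hL
  -- each term
  have hterm : ∀ x' ∈ F, Real.exp (-(κ' * ((linfDist x' y : ℕ) : ℝ))) ≤ Real.exp (κ' * ((L : ℝ) ^ j - 1)) * Real.exp (-(κ' * ((linfDist x y : ℕ) : ℝ))) := by
    intro x' hx'
    rw [← Real.exp_add]
    apply Real.exp_le_exp.2
    have hsame : (blockMap L)^[j] x' = (blockMap L)^[j] x := by
      rw [← blockMapIter_eq_iterate, ← blockMapIter_eq_iterate]; exact (Finset.mem_filter.1 hx').2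
    have hblock := linfDist_le_of_blockMap_iterate_eq (d := d) hL j hsame
    have hdist : ((linfDist x' x : ℕ) : ℝ) + 1 ≤ (L : ℝ) ^ j := by exact_mod_cast hblock
    have htri : ((linfDist x y : ℕ) : ℝ) ≤ ((linfDist x x' : ℕ) : ℝ) + ((linfDist x' y : ℕ) : ℝ) := by exact_mod_cast LatticeNorms.linfDist_triangle x x' y
    rw [LatticeNorms.linfDist_comm x x'] at htri
    nlinarith
  have hcard : ((F.card : ℕ) : ℝ) ≤ ((L : ℝ) ^ d) ^ j := card_filter_blockMapIter_le (s := s) (L := L) j (blockMapIter L j x)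
  have hw0 : 0 ≤ (((L : ℝ) ^ d)⁻¹) ^ j := by positivity
  calc (((L : ℝ) ^ d)⁻¹) ^ j * ∑ x' ∈ F, Real.exp (-(κ' * ((linfDist x' y : ℕ) : ℝ)))
      ≤ (((L : ℝ) ^ d)⁻¹) ^ j * ∑ x' ∈ F, Real.exp (κ' * ((L : ℝ) ^ j - 1)) * Real.exp (-(κ' * ((linfDist x y : ℕ) : ℝ))) :=
        mul_le_mul_of_nonneg_left (Finset.sum_le_sum hterm) hw0
    _ = ((((L : ℝ) ^ d)⁻¹) ^ j * F.card) * (Real.exp (κ' * ((L : ℝ) ^ j - 1)) * Real.exp (-(κ' * ((linfDist x y : ℕ) : ℝ)))) := by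
        rw [Finset.sum_const, nsmul_eq_mul]; ring
    _ ≤ 1 * (Real.exp (κ' * ((L : ℝ) ^ j - 1)) * Real.exp (-(κ' * ((linfDist x y : ℕ) : ℝ)))) := by
        refine mul_le_mul_of_nonneg_right ?_ (by positivity)
        rw [inv_pow, inv_mul_le_iff₀ (by positivity), mul_one]
        exact hcard
    _ = Real.exp (κ' * ((L : ℝ) ^ j - 1)) * Real.exp (-(κ' * ((linfDist x y : ℕ) : ℝ))) := one_mul _

end OffSource

/-! ## §4  ★★★ The Laplacian entry from a kernel majorant; the coarse edition -/

section Laplacian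

variable (L : ℕ) (U₀ : Site d → Fin d → 𝔸ˣ) (η : ℝ) (τ : 𝔸 →ₗ[ℂ] ℂ) [FiniteDimensional ℝ 𝔸]
  (hτp : ∀ a : 𝔸, a ≠ 0 → 0 < (τ (star a * a)).re) (m : ℕ) (a : ℕ → ℝ) (Λ : ℕ → Finset (Site d)) (s : Finset (Site d))

/-- ★★★ **THE LAPLACIAN ENTRY FROM A KERNEL MAJORANT.**  `L ≥ 1`; unitary `U₀` with unitary averaged transporters below `m`; `a ≥ 0`; tracial Hermitian faithful `τ`; `y ∈ Ω₀`;
a pointwise majorant `|(G′(U₀)δ_y w)(x′)|_τ ≤ K·e^{−κ′|x′−y|_∞}` for `x′ ∈ Ω₀` (`K, κ′ ≥ 0`).  THEN for `x ∈ Ω₀`, `x ≠ y`: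
`|(Δ^η_{U₀}G′(U₀)δ_y w)(x)|_τ ≤ (Σ_{j≤m}𝟙[yʲ(x)∈Λ_j]·a_j(Lᵈ)^{−j}·e^{κ′(Lʲ−1)})·K·e^{−κ′|x−y|_∞}`.
[cite: Balaban1985BackgroundPropagators, (3.42) p.397, (3.46) p.398, (3.24) p.394] -/
theorem fnorm_covLap_GpZd_single_le_of_kernelBound [NeZero L] (hd : 0 < d) (hη : η ≠ 0) (hL : 1 ≤ L) (hτt : ∀ a b : 𝔸, τ (a * b) = τ (b * a))
    (hτs : ∀ a : 𝔸, τ (star a) = starRingEnd ℂ (τ a)) (hU : ∀ (x : Site d) (κ : Fin d), U₀ x κ ∈ unitaryUnits 𝔸)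
    (hT : ∀ j', j' < m → ∀ z y : Site d, bgT L U₀ j' z y ∈ unitaryUnits 𝔸) (ha : ∀ j, 0 ≤ a j)
    {y : Site d} (hy : y ∈ s) (w : 𝔸) {K κ' : ℝ} (hK : 0 ≤ K) (hκ' : 0 ≤ κ')
    (hker : ∀ x' ∈ s, fnorm τ ((GpZd L U₀ η τ hτp m a Λ s hd hη hτt hτs hU ha (restrictSite s (single y w)) : Site d → 𝔸) x') ≤
      K * Real.exp (-(κ' * ((linfDist x' y : ℕ) : ℝ))))
    {x : Site d} (hx : x ∈ s) (hxy : x ≠ y) :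
    fnorm τ (covLap η U₀ (GpZd L U₀ η τ hτp m a Λ s hd hη hτt hτs hU ha (restrictSite s (single y w)) : Site d → 𝔸) x) ≤
      (∑ j ∈ Finset.range (m + 1), (if blockMapIter L j x ∈ Λ j then a j * (((L : ℝ) ^ d)⁻¹) ^ j * Real.exp (κ' * ((L : ℝ) ^ j - 1)) else 0)) *
        (K * Real.exp (-(κ' * ((linfDist x y : ℕ) : ℝ)))) := by
  classical
  set Φ := GpZd L U₀ η τ hτp m a Λ s hd hη hτt hτs hU ha (restrictSite s (single y w)) with hΦ
  have hΨx : (restrictSite s (single y w) : Site d → 𝔸) x = 0 := by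
    rw [restrictSite_single_coe hy, single_apply_of_ne hxy]
  rw [fnorm_covLap_GpZd_eq_off L U₀ η τ hτp m a Λ s hd hη hτt hτs hU ha _ hx hΨx]
  refine (fnorm_penalty_apply_le τ hτp hτt hτs hT ha Λ Φ x).trans ?_
  rw [Finset.sum_mul]
  refine Finset.sum_le_sum fun j hj => ?_
  by_cases hmem : blockMapIter L j x ∈ Λ j
  · rw [if_pos hmem, if_pos hmem]
    -- the block average of the kernel majorant
    have hblk : (((L : ℝ) ^ d)⁻¹) ^ j * ∑ x' ∈ s.filter (fun x' => blockMapIter L j x' = blockMapIter L j x), fnorm τ ((Φ : Site d → 𝔸) x') ≤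
        K * (Real.exp (κ' * ((L : ℝ) ^ j - 1)) * Real.exp (-(κ' * ((linfDist x y : ℕ) : ℝ)))) := by
      have h1 : ∑ x' ∈ s.filter (fun x' => blockMapIter L j x' = blockMapIter L j x), fnorm τ ((Φ : Site d → 𝔸) x') ≤
          ∑ x' ∈ s.filter (fun x' => blockMapIter L j x' = blockMapIter L j x), K * Real.exp (-(κ' * ((linfDist x' y : ℕ) : ℝ))) :=
        Finset.sum_le_sum fun x' hx' => hker x' (Finset.mem_filter.1 hx').1
      have h2 := blockAvg_exp_le (s := s) L hL hκ' j x y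
      calc (((L : ℝ) ^ d)⁻¹) ^ j * ∑ x' ∈ s.filter (fun x' => blockMapIter L j x' = blockMapIter L j x), fnorm τ ((Φ : Site d → 𝔸) x')
          ≤ (((L : ℝ) ^ d)⁻¹) ^ j * ∑ x' ∈ s.filter (fun x' => blockMapIter L j x' = blockMapIter L j x), K * Real.exp (-(κ' * ((linfDist x' y : ℕ) : ℝ))) :=
            mul_le_mul_of_nonneg_left h1 (by positivity)
        _ = K * ((((L : ℝ) ^ d)⁻¹) ^ j * ∑ x' ∈ s.filter (fun x' => blockMapIter L j x' = blockMapIter L j x), Real.exp (-(κ' * ((linfDist x' y : ℕ) : ℝ)))) := by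
            rw [← Finset.mul_sum]; ring
        _ ≤ K * (Real.exp (κ' * ((L : ℝ) ^ j - 1)) * Real.exp (-(κ' * ((linfDist x y : ℕ) : ℝ)))) := mul_le_mul_of_nonneg_left h2 hK
    calc a j * ((((L : ℝ) ^ d)⁻¹) ^ j * ((((L : ℝ) ^ d)⁻¹) ^ j * ∑ x' ∈ s.filter (fun x' => blockMapIter L j x' = blockMapIter L j x), fnorm τ ((Φ : Site d → 𝔸) x')))
        ≤ a j * ((((L : ℝ) ^ d)⁻¹) ^ j * (K * (Real.exp (κ' * ((L : ℝ) ^ j - 1)) * Real.exp (-(κ' * ((linfDist x y : ℕ) : ℝ)))))) :=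
          mul_le_mul_of_nonneg_left (mul_le_mul_of_nonneg_left hblk (by positivity)) (ha j)
      _ = a j * (((L : ℝ) ^ d)⁻¹) ^ j * Real.exp (κ' * ((L : ℝ) ^ j - 1)) * (K * Real.exp (-(κ' * ((linfDist x y : ℕ) : ℝ)))) := by ring
  · rw [if_neg hmem, if_neg hmem, zero_mul]

/-- ★★★ **THE COARSE EDITION — (3.42)'s n = 2 ∕ (3.46)'s LAPLACIAN ENTRY WITH EXPLICIT UNIFORM CONSTANTS.**  Data as in
`B9Thm31GpAgmonDecayCoarseZd.fnorm_GpZd_single_le_exp_coarse` (displayed `hco`, scaling slots `η⁻²L^{−2m} ≤ B·M`, `Σ_j𝟙a_j(Lᵈ)^{−j} ≤ A·M`, `0 ≤ κ ≤ 1`, `κ(6dB + 15A) ≤ θc₀`),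
plus a mass floor `0 < M_lo ≤ M` on `Ω₀`.  THEN for `x, y ∈ Ω₀`, `x ≠ y`:
`|(Δ^η_{U₀}G′(U₀)δ_y w)(x)|_τ ≤ (e·A·M(x)∕((1−θ)c₀·√(M_lo·M_y)))·e^{−κL^{−m}|x−y|_∞}·|w|_τ` — print's `B₀(Lʲ′η)∕(Lʲη)·e^{−δ₀d}` at level masses (`A·M(x) ≈ a(L^{j}η)⁻²`).
[cite: Balaban1985BackgroundPropagators, (3.42) p.397, (3.46) p.398, Thm 3.1 p.397, (3.24) p.394; Agmon1982, Thm 1.5 p.19] -/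
theorem fnorm_covLap_GpZd_single_le_coarse [NeZero L] (hd : 0 < d) (hη : η ≠ 0) (hL : 1 ≤ L) (hτt : ∀ a b : 𝔸, τ (a * b) = τ (b * a))
    (hτs : ∀ a : 𝔸, τ (star a) = starRingEnd ℂ (τ a)) (hU : ∀ (x : Site d) (κ : Fin d), U₀ x κ ∈ unitaryUnits 𝔸)
    (hT : ∀ j', j' < m → ∀ z y : Site d, bgT L U₀ j' z y ∈ unitaryUnits 𝔸) (ha : ∀ j, 0 ≤ a j)
    {c₀ θ : ℝ} (hc₀ : 0 < c₀) (hθ0 : 0 ≤ θ) (hθ1 : θ < 1) {M : Site d → ℝ} {mlo : ℝ} (hmlo : 0 < mlo) (hMlo : ∀ z ∈ s, mlo ≤ M z)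
    (hco : ∀ Φ : suppSub (𝔸 := 𝔸) s, c₀ * ∑ z ∈ s, M z * fnorm τ ((Φ : Site d → 𝔸) z) ^ 2 ≤ formE τ s Φ (deltaPrimeADom L U₀ η τ hτp m a Λ s Φ))
    {A B κ : ℝ} (hκ0 : 0 ≤ κ) (hκ1 : κ ≤ 1) (hκ : κ * (6 * d * B + 15 * A) ≤ θ * c₀)
    (hB : ∀ z ∈ s, (η⁻¹) ^ 2 * (((L : ℝ) ^ m)⁻¹) ^ 2 ≤ B * M z)
    (hA : ∀ z ∈ s, ∑ j ∈ Finset.range (m + 1), (if blockMapIter L j z ∈ Λ j then a j * (((L : ℝ) ^ d)⁻¹) ^ j else 0) ≤ A * M z)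
    {x y : Site d} (hx : x ∈ s) (hy : y ∈ s) (hxy : x ≠ y) (w : 𝔸) :
    fnorm τ (covLap η U₀ (GpZd L U₀ η τ hτp m a Λ s hd hη hτt hτs hU ha (restrictSite s (single y w)) : Site d → 𝔸) x) ≤
      Real.exp 1 * A * M x / ((1 - θ) * c₀ * Real.sqrt (mlo * M y)) * Real.exp (-(κ * (((L : ℝ) ^ m)⁻¹ * ((linfDist x y : ℕ) : ℝ)))) * fnorm τ w := by
  have hL0 : (0 : ℝ) < L := by exact_mod_cast hL
  have hM0 : ∀ z ∈ s, 0 ≤ M z := fun z hz => hmlo.le.trans (hMlo z hz)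
  have hMy : 0 < M y := hmlo.trans_le (hMlo y hy)
  have hθ' : 0 < 1 - θ := by linarith
  -- the kernel majorant from FILE 4, floored by `M_lo`
  set K : ℝ := fnorm τ w / ((1 - θ) * c₀ * Real.sqrt (mlo * M y)) with hK
  have hden : 0 < (1 - θ) * c₀ * Real.sqrt (mlo * M y) := by have := Real.sqrt_pos.2 (mul_pos hmlo hMy); positivity
  have hK0 : 0 ≤ K := div_nonneg (fnorm_nonneg τ w) hden.le
  set κ' : ℝ := κ * ((L : ℝ) ^ m)⁻¹ with hκ'
  have hκ'0 : 0 ≤ κ' := by positivity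
  have hker : ∀ x' ∈ s, fnorm τ ((GpZd L U₀ η τ hτp m a Λ s hd hη hτt hτs hU ha (restrictSite s (single y w)) : Site d → 𝔸) x') ≤
      K * Real.exp (-(κ' * ((linfDist x' y : ℕ) : ℝ))) := by
    intro x' hx'
    have hMx' : 0 < M x' := hmlo.trans_le (hMlo x' hx')
    have h := fnorm_GpZd_single_le_exp_coarse L U₀ η τ hτp m a Λ s hd hη hL hτt hτs hU hT ha hc₀ hθ0 hθ1 hM0 hco hκ0 hκ1 hκ hB hA hy w hMx' hMy
    refine h.trans ?_
    have hs : Real.sqrt (mlo * M y) ≤ Real.sqrt (M x' * M y) := Real.sqrt_le_sqrt (mul_le_mul_of_nonneg_right (hMlo x' hx') hMy.le)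
    have hD : (1 - θ) * c₀ * Real.sqrt (mlo * M y) ≤ (1 - θ) * c₀ * Real.sqrt (M x' * M y) := mul_le_mul_of_nonneg_left hs (by positivity)
    have hexp : Real.exp (-(κ * (((L : ℝ) ^ m)⁻¹ * ((linfDist x' y : ℕ) : ℝ)))) = Real.exp (-(κ' * ((linfDist x' y : ℕ) : ℝ))) := by
      rw [hκ', mul_assoc]
    have hE0 := (Real.exp_pos (-(κ' * ((linfDist x' y : ℕ) : ℝ)))).le
    calc Real.exp (-(κ * (((L : ℝ) ^ m)⁻¹ * ((linfDist x' y : ℕ) : ℝ)))) / ((1 - θ) * c₀ * Real.sqrt (M x' * M y)) * fnorm τ w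
        = fnorm τ w * Real.exp (-(κ' * ((linfDist x' y : ℕ) : ℝ))) / ((1 - θ) * c₀ * Real.sqrt (M x' * M y)) := by rw [hexp]; ring
      _ ≤ fnorm τ w * Real.exp (-(κ' * ((linfDist x' y : ℕ) : ℝ))) / ((1 - θ) * c₀ * Real.sqrt (mlo * M y)) :=
          div_le_div_of_nonneg_left (mul_nonneg (fnorm_nonneg τ w) hE0) hden hD
      _ = K * Real.exp (-(κ' * ((linfDist x' y : ℕ) : ℝ))) := by rw [hK]; ring
  have hmain := fnorm_covLap_GpZd_single_le_of_kernelBound L U₀ η τ hτp m a Λ s hd hη hL hτt hτs hU hT ha hy w hK0 hκ'0 hker hx hxy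
  refine hmain.trans ?_
  -- the prefactor: `e^{κ′(Lʲ − 1)} ≤ e` and the scaling slot
  have hpre : ∑ j ∈ Finset.range (m + 1), (if blockMapIter L j x ∈ Λ j then a j * (((L : ℝ) ^ d)⁻¹) ^ j * Real.exp (κ' * ((L : ℝ) ^ j - 1)) else 0) ≤
      Real.exp 1 * (A * M x) := by
    have hterm : ∀ j ∈ Finset.range (m + 1), (if blockMapIter L j x ∈ Λ j then a j * (((L : ℝ) ^ d)⁻¹) ^ j * Real.exp (κ' * ((L : ℝ) ^ j - 1)) else 0) ≤
        Real.exp 1 * (if blockMapIter L j x ∈ Λ j then a j * (((L : ℝ) ^ d)⁻¹) ^ j else 0) := by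
      intro j hj
      have hjm : j ≤ m := Nat.lt_succ_iff.1 (Finset.mem_range.1 hj)
      by_cases hmem : blockMapIter L j x ∈ Λ j
      · rw [if_pos hmem, if_pos hmem]
        have hexp : Real.exp (κ' * ((L : ℝ) ^ j - 1)) ≤ Real.exp 1 := by
          apply Real.exp_le_exp.2
          have hLj : (L : ℝ) ^ j ≤ (L : ℝ) ^ m := pow_le_pow_right₀ (by exact_mod_cast hL) hjm
          have hLm : 0 < (L : ℝ) ^ m := by positivity
          rw [hκ']
          have h1 : ((L : ℝ) ^ m)⁻¹ * ((L : ℝ) ^ j - 1) ≤ 1 := by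
            rw [inv_mul_le_iff₀ hLm]; linarith
          calc κ * ((L : ℝ) ^ m)⁻¹ * ((L : ℝ) ^ j - 1) = κ * (((L : ℝ) ^ m)⁻¹ * ((L : ℝ) ^ j - 1)) := by ring
            _ ≤ 1 * 1 := by
                refine mul_le_mul hκ1 h1 ?_ zero_le_one
                have : (1 : ℝ) ≤ (L : ℝ) ^ j := one_le_pow₀ (by exact_mod_cast hL)
                exact mul_nonneg (inv_nonneg.2 hLm.le) (by linarith)
            _ = 1 := one_mul 1
        have hw : 0 ≤ a j * (((L : ℝ) ^ d)⁻¹) ^ j := mul_nonneg (ha j) (by positivity)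
        calc a j * (((L : ℝ) ^ d)⁻¹) ^ j * Real.exp (κ' * ((L : ℝ) ^ j - 1)) ≤ a j * (((L : ℝ) ^ d)⁻¹) ^ j * Real.exp 1 :=
              mul_le_mul_of_nonneg_left hexp hw
          _ = Real.exp 1 * (a j * (((L : ℝ) ^ d)⁻¹) ^ j) := by ring
      · rw [if_neg hmem, if_neg hmem, mul_zero]
    calc ∑ j ∈ Finset.range (m + 1), (if blockMapIter L j x ∈ Λ j then a j * (((L : ℝ) ^ d)⁻¹) ^ j * Real.exp (κ' * ((L : ℝ) ^ j - 1)) else 0)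
        ≤ ∑ j ∈ Finset.range (m + 1), Real.exp 1 * (if blockMapIter L j x ∈ Λ j then a j * (((L : ℝ) ^ d)⁻¹) ^ j else 0) := Finset.sum_le_sum hterm
      _ = Real.exp 1 * ∑ j ∈ Finset.range (m + 1), (if blockMapIter L j x ∈ Λ j then a j * (((L : ℝ) ^ d)⁻¹) ^ j else 0) := by rw [Finset.mul_sum]
      _ ≤ Real.exp 1 * (A * M x) := mul_le_mul_of_nonneg_left (hA x hx) (Real.exp_pos 1).le
  have hE : 0 ≤ K * Real.exp (-(κ' * ((linfDist x y : ℕ) : ℝ))) := by positivity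
  calc (∑ j ∈ Finset.range (m + 1), (if blockMapIter L j x ∈ Λ j then a j * (((L : ℝ) ^ d)⁻¹) ^ j * Real.exp (κ' * ((L : ℝ) ^ j - 1)) else 0)) *
        (K * Real.exp (-(κ' * ((linfDist x y : ℕ) : ℝ))))
      ≤ Real.exp 1 * (A * M x) * (K * Real.exp (-(κ' * ((linfDist x y : ℕ) : ℝ)))) := mul_le_mul_of_nonneg_right hpre hE
    _ = Real.exp 1 * A * M x / ((1 - θ) * c₀ * Real.sqrt (mlo * M y)) * Real.exp (-(κ * (((L : ℝ) ^ m)⁻¹ * ((linfDist x y : ℕ) : ℝ)))) * fnorm τ w := by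
        rw [hK, hκ']; ring

end Laplacian

end Literature.MathematicalPhysics.QuantumFieldTheory.Balaban1983to89.B9Eq346AgmonLaplacianZd

end
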